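import Literature.MathematicalPhysics.QuantumFieldTheory.Balaban1983to89.B4TorusKernel

/-!
# `BalabanUV.Beta.GAN24.LatticeKernelConvolution` — binder row G-an2-4 / (CONV-C), STENCIL slot, campaign «E3Shape» (`SKELETON-S3.md` v0.2
# node S3-L1 «two-momentum Bloch form of a sandwich `mmRead_N (K_N ∘ V ∘ K_N)`», ANALYSIS HALF): THE PRODUCT ∕ CONVOLUTION THEOREM for
# pv17's lattice kernels — `Σ'_{w ∈ ℤ^{d+1}} K[A](x − w) · K[C](w − y) = K[A·C](x − y)` for strip-regular symbols — a generic engine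

NOT IN PRINT; OUR BOOKKEEPING (engine «LK-CONV*» part 1, CLAIMS l.4153 ∕ l.4206; FILED on the row owner's ruling «FILE IT as `GAN24/LatticeKernelConvolution`»,
gan24-p1-g3 RULINGS-2 l.4221; unit b2b-balaban-gan24-formalise-leaf-07, gen 9).  HONEST FRAMING
(cell contract, verbatim): «discharging `BetaPertH` makes Bałaban's UV stability UNCONDITIONAL — a real constructive-QFT result; it is NOT the
continuum limit and NOT the Clay problem.»  HONEST DEPENDENCY (verbatim): «continuum YM on T⁴ ⇐ BetaPertH ∧ nine spine estimates (0/9 proved);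
BetaPertH ⇐ (D1) ∧ (D4) ∧ CAP+tail; G-an2-4 gates asym, D1 and NE2/3/4.»  [folklore] Fourier analysis on `ℤ^{d+1}`: cites nothing, mints no
`def … : Prop`, asserts no statement of Bałaban's, instantiates no wall binder.  NOT summit progress.

## Why (context only; asserted nowhere below)

an2's third-jet stencil `e3Of n = −mmRead (Lc^n) (K_N ∘ vertexOf (Sc (n−1)) ∘ K_N)` is a SANDWICH of kernels composed by `ExpKernelCalculus.comp` /
`OneStepResolventKernel.wsum`, i.e. by INFINITE sums over intermediate lattice sites, and every factor is (the real part of) a lattice kernel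
`K[G](x) = (2π)^{-(d+1)} ∫_{[-π,π]^{d+1}} G(p) e^{ip·x} dp` of an explicit symbol (`CombesThomasFibre.KInv_eq_re_latticeKernel`).  Road P1 read
FINITELY many entries (`dec`/`unitK`), so the tree's lattice-kernel calculus stops at linearity and phases (`latticeKernel_{sub,const_mul,sum_mul,
phase_mul,congr}`); writing the sandwich as ONE (two-momentum) kernel of a PRODUCT symbol — S3-L1 — needs the convolution theorem
`Σ'_w K[A](x − w) K[C](w − y) = K[A·C](x − y)`.  THIS FILE proves it for strip-regular `A, C` (`B4ContourShift.StripRegular _ κ _`, `κ > 0`), by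
pv07's torus dictionary (`B4TorusKernel.descendC`, `mFourierCoeff_descend : ĉ(n) = K[G](−n)`), Mathlib's pointwise multi-variable Fourier
series `UnitAddTorus.hasSum_mFourier_series_apply_of_summable` (coefficients summable by `latticeKernel_decay`), and the exchange of the
absolutely convergent series with the cell integral (`MeasureTheory.integral_tsum_of_summable_integral_norm`).

## Contents (all [folklore]; lattice `ℤ^{d+1}`, symbols `A, C : ℂ^{d+1} → ℂ`)
§1 the descent is bounded (`norm_descend_le`), its coefficients are summable (`summable_mFourierCoeff_descend`), its Fourier series converges
   pointwise (`hasSum_descend`, `tsum_descend`).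
§2 the unit cell `cell d = ∏ (−½, ½]` of `ℝ^{d+1}` (finite measure, inside the compact box), the lift `toT`, continuity ∕ integrability of the
   twisted terms `F n x = ĉ_C(n) · e_z(x) e_n(x) · A(x)` and the bound `∫_cell ‖F n‖ ≤ ‖ĉ_C(n)‖ · M_A · vol`.
§3 **`tsum_latticeKernel_mul : Σ'_w K[A](z − w) · K[C](w) = K[A·C](z)`**, the summability `summable_latticeKernel_mul`, and the two-point form
   **`tsum_latticeKernel_mul_sub : Σ'_w K[A](x − w) · K[C](w − y) = K[A·C](x − y)`** (+ `HasSum` versions).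
WHAT IS NOT HERE: reflection ∕ conjugation ∕ REALITY of the kernel and the `Re`-read product theorem (sibling `GAN24/LatticeKernelReality`); the
two-momentum forms `Σ'_w K[A](x−w)·K₂[V](w,y) = K₂[A(p)V(p,q)](x,y)` (LK-CONV part 2, on leaf-14-g15's `GAN24/StripRegularBiLoc.latticeKernel₂` once it
lands — same proof on the joint torus); any symbol of an2's objects.  NOT BetaPertH, NOT continuum, NOT Clay.
-/

noncomputable section

open Complex Set MeasureTheory Filter Topology
open Literature.MathematicalPhysics.QuantumFieldTheory.Balaban1983to89
open B4Strip (ofRealVec Strip)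
open B4ContourShift (BZ latticeKernel StripRegular supNorm latticeKernel_decay ofRealVec_mem_Strip)
open B4TorusKernel (rep rep_mem descend descendC descendC_apply unitBox two_pi_mul_mem_BZ mFourierCoeff_descend
  norm_mFourierCoeff_descend_le summable_of_decay)
open UnitAddTorus
open scoped Real

namespace Summit.QuantumFields.BalabanUV.Beta.GAN24.LatticeKernelConvolution

variable {d : ℕ}

/-! ## §1 The descent: bound, summable coefficients, pointwise Fourier series -/

/-- [folklore] the origin is a zone point. -/
theorem zero_mem_BZ : (fun _ => (0 : ℝ)) ∈ BZ (d + 1) :=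
  ⟨fun _ => neg_nonpos.mpr Real.pi_pos.le, fun _ => Real.pi_pos.le⟩

/-- [folklore] the bound of a strip-regular symbol is nonnegative. -/
theorem stripRegular_nonneg {G : (Fin (d + 1) → ℂ) → ℂ} {κ M : ℝ} (h : StripRegular G κ M) (hκ : 0 ≤ κ) : 0 ≤ M :=
  (norm_nonneg _).trans (h.bound _ (ofRealVec_mem_Strip hκ zero_mem_BZ))

/-- [folklore] the descent of a strip-regular symbol is bounded by the strip bound: `‖G(2π rep t)‖ ≤ M`. -/
theorem norm_descend_le {G : (Fin (d + 1) → ℂ) → ℂ} {κ M : ℝ} (h : StripRegular G κ M) (hκ : 0 ≤ κ)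
    (t : UnitAddTorus (Fin (d + 1))) : ‖descend G t‖ ≤ M := by
  unfold descend
  refine h.bound _ (ofRealVec_mem_Strip hκ (two_pi_mul_mem_BZ ?_))
  exact ⟨fun i => (rep_mem (t i)).1, fun i => (rep_mem (t i)).2.le⟩

/-- [folklore] the Fourier coefficients of the descent of a strip-regular symbol (`κ > 0`) are absolutely summable. -/
theorem summable_mFourierCoeff_descend {G : (Fin (d + 1) → ℂ) → ℂ} {κ M : ℝ} (h : StripRegular G κ M) (hκ : 0 < κ) :
    Summable (mFourierCoeff (descendC G h hκ.le)) :=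
  summable_of_decay _ hκ (norm_mFourierCoeff_descend_le h hκ.le)

/-- [folklore] POINTWISE FOURIER SERIES of the descent: `G(2π rep t) = Σ_n ĉ(n) e_n(t)` (Mathlib's `hasSum_mFourier_series_apply_of_summable`). -/
theorem hasSum_descend {G : (Fin (d + 1) → ℂ) → ℂ} {κ M : ℝ} (h : StripRegular G κ M) (hκ : 0 < κ)
    (t : UnitAddTorus (Fin (d + 1))) :
    HasSum (fun n => mFourierCoeff (descendC G h hκ.le) n * mFourier n t) (descend G t) := by
  have h1 := hasSum_mFourier_series_apply_of_summable (summable_mFourierCoeff_descend h hκ) t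
  simpa only [smul_eq_mul, descendC_apply] using h1

/-- [folklore] the same as a `tsum` identity. -/
theorem tsum_descend {G : (Fin (d + 1) → ℂ) → ℂ} {κ M : ℝ} (h : StripRegular G κ M) (hκ : 0 < κ)
    (t : UnitAddTorus (Fin (d + 1))) :
    ∑' n, mFourierCoeff (descendC G h hκ.le) n * mFourier n t = descend G t :=
  (hasSum_descend h hκ t).tsum_eq

/-! ## §2 The unit cell of `ℝ^{d+1}`, the lift to the torus, and the twisted terms -/

/-- [folklore] the half-open unit cell `∏_i (−½, ½]` of `ℝ^{d+1}` (the integration domain of `UnitAddTorus.mFourierCoeff_eq_integral` at `a = −½`). -/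
def cell (d : ℕ) : Set (Fin (d + 1) → ℝ) := {x | ∀ i, x i ∈ Ioc (-(1 / 2 : ℝ)) (-(1 / 2 : ℝ) + 1)}

/-- [folklore] the cell lies in the closed box `[−½, ½]^{d+1}`. -/
theorem cell_subset_Icc : cell d ⊆ Icc (fun _ => -(1 / 2 : ℝ)) (fun _ => (1 / 2 : ℝ)) := by
  intro x hx
  refine ⟨fun i => (hx i).1.le, fun i => ?_⟩
  have := (hx i).2
  show x i ≤ 1 / 2
  linarith

/-- [folklore] the cell has finite Lebesgue measure. -/
theorem volume_cell_lt_top : volume (cell d) < ⊤ :=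
  lt_of_le_of_lt (measure_mono cell_subset_Icc) measure_Icc_lt_top

/-- [folklore] the cell is measurable. -/
theorem measurableSet_cell : MeasurableSet (cell d) := by
  have e : cell d = Set.pi univ (fun _ => Ioc (-(1 / 2 : ℝ)) (-(1 / 2 : ℝ) + 1)) := by
    ext x; simp [cell]
  rw [e]
  exact MeasurableSet.univ_pi fun _ => measurableSet_Ioc

/-- [folklore] THE LIFT of a real vector to the unit torus `(ℝ/ℤ)^{d+1}`. -/
def toT (x : Fin (d + 1) → ℝ) : UnitAddTorus (Fin (d + 1)) := fun i => ((x i : ℝ) : UnitAddCircle)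

/-- [folklore] the lift is continuous. -/
theorem continuous_toT : Continuous (toT : (Fin (d + 1) → ℝ) → UnitAddTorus (Fin (d + 1))) :=
  continuous_pi fun i => (AddCircle.continuous_mk' (1 : ℝ)).comp (continuous_apply i)

/-- [folklore] Mathlib's coefficient formula on the cell, in this file's notation: `ĉ(n) = ∫_cell e_{−n}(x) f(x) dx`. -/
theorem mFourierCoeff_eq_setIntegral_cell (f : C(UnitAddTorus (Fin (d + 1)), ℂ)) (n : Fin (d + 1) → ℤ) :
    mFourierCoeff f n = ∫ x in cell d, mFourier (-n) (toT x) * f (toT x) := by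
  rw [UnitAddTorus.mFourierCoeff_eq_integral f n (fun _ => -(1 / 2 : ℝ))]
  rfl

/-- [folklore] the characters have modulus at most one. -/
theorem norm_mFourier_apply_le (n : Fin (d + 1) → ℤ) (t : UnitAddTorus (Fin (d + 1))) : ‖mFourier n t‖ ≤ 1 :=
  ((mFourier n).norm_coe_le_norm t).trans (mFourier_norm (n := n)).le

section Terms

variable {A C : (Fin (d + 1) → ℂ) → ℂ} {κ MA MC : ℝ}

/-- [folklore] THE TWISTED TERM `F n x = ĉ_C(n) · (e_z(x) e_n(x) · A(2π rep x))` of the product computation. -/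
def term (hA : StripRegular A κ MA) (hC : StripRegular C κ MC) (hκ : 0 < κ) (z n : Fin (d + 1) → ℤ) (x : Fin (d + 1) → ℝ) : ℂ :=
  mFourierCoeff (descendC C hC hκ.le) n * (mFourier z (toT x) * mFourier n (toT x) * descendC A hA hκ.le (toT x))

/-- [folklore] each twisted term is continuous on `ℝ^{d+1}`. -/
theorem continuous_term (hA : StripRegular A κ MA) (hC : StripRegular C κ MC) (hκ : 0 < κ) (z n : Fin (d + 1) → ℤ) :
    Continuous (term hA hC hκ z n) := by
  unfold term
  refine continuous_const.mul ((Continuous.mul ?_ ?_).mul ?_)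
  · exact (mFourier z).continuous.comp continuous_toT
  · exact (mFourier n).continuous.comp continuous_toT
  · exact (descendC A hA hκ.le).continuous.comp continuous_toT

/-- [folklore] the pointwise bound `‖F n x‖ ≤ ‖ĉ_C(n)‖ · M_A`. -/
theorem norm_term_le (hA : StripRegular A κ MA) (hC : StripRegular C κ MC) (hκ : 0 < κ) (z n : Fin (d + 1) → ℤ)
    (x : Fin (d + 1) → ℝ) : ‖term hA hC hκ z n x‖ ≤ ‖mFourierCoeff (descendC C hC hκ.le) n‖ * MA := by
  unfold term
  rw [norm_mul, norm_mul, norm_mul]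
  refine mul_le_mul_of_nonneg_left ?_ (norm_nonneg _)
  have h1 := norm_mFourier_apply_le z (toT x)
  have h2 := norm_mFourier_apply_le n (toT x)
  have h3 : ‖descendC A hA hκ.le (toT x)‖ ≤ MA := by rw [descendC_apply]; exact norm_descend_le hA hκ.le _
  have hMA : 0 ≤ MA := stripRegular_nonneg hA hκ.le
  calc ‖mFourier z (toT x)‖ * ‖mFourier n (toT x)‖ * ‖descendC A hA hκ.le (toT x)‖
      ≤ 1 * 1 * MA := by
        refine mul_le_mul (mul_le_mul h1 h2 (norm_nonneg _) zero_le_one) h3 (norm_nonneg _) (by positivity)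
    _ = MA := by ring

/-- [folklore] each twisted term is integrable on the cell. -/
theorem integrableOn_term (hA : StripRegular A κ MA) (hC : StripRegular C κ MC) (hκ : 0 < κ) (z n : Fin (d + 1) → ℤ) :
    IntegrableOn (term hA hC hκ z n) (cell d) volume :=
  ((continuous_term hA hC hκ z n).continuousOn.integrableOn_compact isCompact_Icc).mono_set cell_subset_Icc

/-- [folklore] the cell integral of the norm of a twisted term: `∫_cell ‖F n‖ ≤ ‖ĉ_C(n)‖ · M_A · vol(cell)`. -/
theorem integral_norm_term_le (hA : StripRegular A κ MA) (hC : StripRegular C κ MC) (hκ : 0 < κ) (z n : Fin (d + 1) → ℤ) :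
    ∫ x in cell d, ‖term hA hC hκ z n x‖ ≤ ‖mFourierCoeff (descendC C hC hκ.le) n‖ * MA * volume.real (cell d) := by
  have h := norm_setIntegral_le_of_norm_le_const (volume_cell_lt_top (d := d))
    (f := fun x => (‖term hA hC hκ z n x‖ : ℝ)) (C := ‖mFourierCoeff (descendC C hC hκ.le) n‖ * MA)
    (fun x _ => by rw [Real.norm_of_nonneg (norm_nonneg _)]; exact norm_term_le hA hC hκ z n x)
  have h0 : 0 ≤ ∫ x in cell d, ‖term hA hC hκ z n x‖ := integral_nonneg fun _ => norm_nonneg _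
  rw [Real.norm_of_nonneg h0] at h
  exact h

/-- [folklore] hence the cell integrals of the norms are summable in `n`. -/
theorem summable_integral_norm_term (hA : StripRegular A κ MA) (hC : StripRegular C κ MC) (hκ : 0 < κ) (z : Fin (d + 1) → ℤ) :
    Summable fun n => ∫ x in cell d, ‖term hA hC hκ z n x‖ := by
  refine Summable.of_nonneg_of_le (fun n => integral_nonneg fun _ => norm_nonneg _) (fun n => integral_norm_term_le hA hC hκ z n) ?_
  exact ((summable_mFourierCoeff_descend hC hκ).norm.mul_right MA).mul_right _

/-- [folklore] THE POINTWISE SUM of the twisted terms: `Σ_n F n x = e_z(x) · A(x) · C(x)` (the Fourier series of `C`). -/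
theorem tsum_term (hA : StripRegular A κ MA) (hC : StripRegular C κ MC) (hκ : 0 < κ) (z : Fin (d + 1) → ℤ) (x : Fin (d + 1) → ℝ) :
    ∑' n, term hA hC hκ z n x = mFourier z (toT x) * (descend A (toT x) * descend C (toT x)) := by
  have e : ∀ n, term hA hC hκ z n x =
      (mFourier z (toT x) * descend A (toT x)) * (mFourierCoeff (descendC C hC hκ.le) n * mFourier n (toT x)) := by
    intro n; unfold term; rw [descendC_apply]; ring
  simp_rw [e]
  rw [tsum_mul_left, tsum_descend hC hκ]
  ring

/-- [folklore] THE CELL INTEGRAL of one twisted term: `∫_cell F n = ĉ_C(n) · ĉ_A(−(z + n))`. -/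
theorem integral_term (hA : StripRegular A κ MA) (hC : StripRegular C κ MC) (hκ : 0 < κ) (z n : Fin (d + 1) → ℤ) :
    ∫ x in cell d, term hA hC hκ z n x =
      mFourierCoeff (descendC C hC hκ.le) n * mFourierCoeff (descendC A hA hκ.le) (-(z + n)) := by
  unfold term
  rw [integral_const_mul, mFourierCoeff_eq_setIntegral_cell (descendC A hA hκ.le) (-(z + n)), neg_neg]
  congr 1
  refine setIntegral_congr_fun measurableSet_cell fun x _ => ?_
  rw [mFourier_add]

end Terms

/-! ## §3 The product ∕ convolution theorem -/

section Product

variable {A C : (Fin (d + 1) → ℂ) → ℂ} {κ MA MC : ℝ}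

/-- [folklore] **THE PRODUCT THEOREM, COEFFICIENT FORM**: `K[A·C](z) = Σ'_n K[C](−n) · K[A](z + n)`. -/
theorem latticeKernel_mul_eq_tsum (hA : StripRegular A κ MA) (hC : StripRegular C κ MC) (hκ : 0 < κ) (z : Fin (d + 1) → ℤ) :
    latticeKernel (fun p => A p * C p) z = ∑' n, latticeKernel C (-n) * latticeKernel A (z + n) := by
  have hAC : StripRegular (fun p => A p * C p) κ (MA * MC) := hA.mul hC (stripRegular_nonneg hA hκ.le)
  -- K[A·C](z) = ĉ_{AC}(−z) = ∫_cell e_z · (A·C)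
  have h1 : latticeKernel (fun p => A p * C p) z = ∫ x in cell d, mFourier z (toT x) * (descend A (toT x) * descend C (toT x)) := by
    have e := mFourierCoeff_descend hAC hκ.le (-z)
    rw [neg_neg] at e
    rw [← e, mFourierCoeff_eq_setIntegral_cell, neg_neg]
    rfl
  -- = ∫_cell Σ_n F n = Σ_n ∫_cell F n
  have h2 : ∫ x in cell d, mFourier z (toT x) * (descend A (toT x) * descend C (toT x)) = ∫ x in cell d, ∑' n, term hA hC hκ z n x :=
    setIntegral_congr_fun measurableSet_cell fun x _ => (tsum_term hA hC hκ z x).symm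
  have h3 : ∫ x in cell d, ∑' n, term hA hC hκ z n x = ∑' n, ∫ x in cell d, term hA hC hκ z n x :=
    (integral_tsum_of_summable_integral_norm (fun n => integrableOn_term hA hC hκ z n) (summable_integral_norm_term hA hC hκ z)).symm
  rw [h1, h2, h3]
  refine tsum_congr fun n => ?_
  rw [integral_term, mFourierCoeff_descend hC hκ.le, mFourierCoeff_descend hA hκ.le, neg_neg]

/-- [folklore] absolute summability of the convolution summand `w ↦ K[A](z − w) · K[C](w)` (bounded × exponentially decaying). -/
theorem summable_latticeKernel_mul (hA : StripRegular A κ MA) (hC : StripRegular C κ MC) (hκ : 0 < κ) (z : Fin (d + 1) → ℤ) :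
    Summable fun w => latticeKernel A (z - w) * latticeKernel C w := by
  have hsC : Summable fun w => latticeKernel C w :=
    summable_of_decay _ hκ (fun w => latticeKernel_decay hC hκ.le w)
  refine Summable.of_norm_bounded (hsC.norm.mul_left MA) fun w => ?_
  rw [norm_mul]
  refine mul_le_mul_of_nonneg_right ?_ (norm_nonneg _)
  refine (latticeKernel_decay hA hκ.le (z - w)).trans ?_
  have hMA : 0 ≤ MA := stripRegular_nonneg hA hκ.le
  have : Real.exp (-(κ * supNorm (z - w))) ≤ 1 :=
    Real.exp_le_one_iff.mpr (by nlinarith [B4ContourShift.supNorm_nonneg (z - w), hκ.le])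
  nlinarith

/-- [folklore] **THE PRODUCT ∕ CONVOLUTION THEOREM** for pv17's lattice kernels: for strip-regular symbols `A, C` (half-width `κ > 0`),
`Σ'_{w ∈ ℤ^{d+1}} K[A](z − w) · K[C](w) = K[A·C](z)` — the kernel of a product of Fourier multipliers is the lattice convolution of the kernels. -/
theorem tsum_latticeKernel_mul (hA : StripRegular A κ MA) (hC : StripRegular C κ MC) (hκ : 0 < κ) (z : Fin (d + 1) → ℤ) :
    ∑' w, latticeKernel A (z - w) * latticeKernel C w = latticeKernel (fun p => A p * C p) z := by
  rw [latticeKernel_mul_eq_tsum hA hC hκ z, ← (Equiv.neg (Fin (d + 1) → ℤ)).tsum_eq]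
  refine tsum_congr fun w => ?_
  show latticeKernel A (z - -w) * latticeKernel C (-w) = latticeKernel C (-w) * latticeKernel A (z + w)
  rw [sub_neg_eq_add, mul_comm]

/-- [folklore] the same as a `HasSum` statement. -/
theorem hasSum_latticeKernel_mul (hA : StripRegular A κ MA) (hC : StripRegular C κ MC) (hκ : 0 < κ) (z : Fin (d + 1) → ℤ) :
    HasSum (fun w => latticeKernel A (z - w) * latticeKernel C w) (latticeKernel (fun p => A p * C p) z) := by
  rw [← tsum_latticeKernel_mul hA hC hκ z]
  exact (summable_latticeKernel_mul hA hC hκ z).hasSum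

/-- [folklore] **TWO-POINT FORM** (the shape of `ExpKernelCalculus.comp` for translation-invariant kernels):
`Σ'_{w ∈ ℤ^{d+1}} K[A](x − w) · K[C](w − y) = K[A·C](x − y)`. -/
theorem tsum_latticeKernel_mul_sub (hA : StripRegular A κ MA) (hC : StripRegular C κ MC) (hκ : 0 < κ) (x y : Fin (d + 1) → ℤ) :
    ∑' w, latticeKernel A (x - w) * latticeKernel C (w - y) = latticeKernel (fun p => A p * C p) (x - y) := by
  rw [← tsum_latticeKernel_mul hA hC hκ (x - y)]
  show ∑' w, latticeKernel A (x - w) * latticeKernel C (w - y) = ∑' u, latticeKernel A (x - y - u) * latticeKernel C u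
  rw [← (Equiv.addRight y).tsum_eq]
  refine tsum_congr fun w => ?_
  show latticeKernel A (x - (w + y)) * latticeKernel C (w + y - y) = latticeKernel A (x - y - w) * latticeKernel C w
  rw [add_sub_cancel_right]
  congr 2
  abel

/-- [folklore] summability of the two-point summand. -/
theorem summable_latticeKernel_mul_sub (hA : StripRegular A κ MA) (hC : StripRegular C κ MC) (hκ : 0 < κ) (x y : Fin (d + 1) → ℤ) :
    Summable fun w => latticeKernel A (x - w) * latticeKernel C (w - y) := by
  have h := (Equiv.subRight y).summable_iff.mpr (summable_latticeKernel_mul hA hC hκ (x - y))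
  refine h.congr fun w => ?_
  show latticeKernel A (x - y - (w - y)) * latticeKernel C (w - y) = latticeKernel A (x - w) * latticeKernel C (w - y)
  congr 2
  abel

/-- [folklore] the two-point form as a `HasSum` statement. -/
theorem hasSum_latticeKernel_mul_sub (hA : StripRegular A κ MA) (hC : StripRegular C κ MC) (hκ : 0 < κ) (x y : Fin (d + 1) → ℤ) :
    HasSum (fun w => latticeKernel A (x - w) * latticeKernel C (w - y)) (latticeKernel (fun p => A p * C p) (x - y)) := by
  rw [← tsum_latticeKernel_mul_sub hA hC hκ x y]
  exact (summable_latticeKernel_mul_sub hA hC hκ x y).hasSum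

end Product

end Summit.QuantumFields.BalabanUV.Beta.GAN24.LatticeKernelConvolution

end
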